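import Summits.ResolutionOfSingularities.ResolutionOfSingularities.Theorems.MarkedTransferCampaignW13BypassCriteria
import Literature.AlgebraicGeometry.Resolution.HasseSchmidtCoefficients
import Mathlib.Algebra.MvPolynomial.PDeriv
import Mathlib.Algebra.MvPolynomial.Supported
import Mathlib.Algebra.CharP.Lemmas
import Mathlib.Tactic.LinearCombination
import HarnessLib

/-!
# [OURS · L1 W1.3] Reading R-flat, rung 1 — the tail-power condition `RFlatTailPow` on the second disjoint check (a):
# Example A, the `p = 3` specimen R2, one `e = 2` head (seat res-L1-s13-pv-1; heads B / C / D in the sibling file `…BCD`)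

LADDER-RESOLUTION rung L (rescue), cell `res-hironaka`, RESCUE-SEED slot W1.3, campaign s13. By the director's RULING
2026-08-26T20:36:49Z (2) the s13 campaign reading is R-flat and its rung 1 is kill test K1.3's «first obligation + second
disjoint check» (HOME/L/res-L1-k13/KILL-TEST-K1.3.md §4): «`y(e)^q ∈ ℘(Ě,1)` for every LL-chain at every level …
SECOND, DISJOINT CHECK: (a) Example A (`y²+x⁵`), the `p = 3` specimen R2, and one `e = 2` head (`q = 4`); (b) res-L1-repro-2
re-derivation of j259562» — (b) done (REPRO MATCH j259840, 2026-08-26T20:40:31Z); (a) «is yours» (res-L1-k13 CLOSE-OUT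
20:57:50Z). This file discharges (a) in the kernel (the sibling `MarkedTransferCampaignW13BypassRFlatInstancesBCD.lean`
re-derives K1.3's B/C/D column the same way) IN THE BOUND VOCABULARY: for each
head `g` of an ideal exponent `Ě = ((g), b)` over a polynomial ring `O = 𝔽_p[x…, y]` (sections over the affine chart),
the recomputed total knock-out `g − y(e)^q` is exhibited as a value of `K`-linear differential operators of order `< b`
on `g` (times ring elements), so `y(e)^q ∈ Diff^{(j)}(J)·O ⊆ ℘(Ě,1)` for the BOUND algebraic `℘` (v3 `Campaign.pAlgPiece`,
bridge `Campaign.W13.diffIdeal_le_pAlgPiece_one` of p475548), i.e. v4's `Campaign.RFlatTailPow p K J b d` holds for every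
chain datum `d : S09LLUED.LLChainData O` (row 061/063) with that exponent and that tail — whatever chain predicate the
planner's CAMPAIGN.md finally binds (v4 `RFlatTailPowOn`'s parameter). Objects only from p473358 (v4) / p475548; helper
filed `--supports stmt-ResolutionOfSingularities-15522`; PROOFS ONLY, no new objects.

THE THREE HEADS (`p`, `q = p^e`, coordinates, knock-outs, tail; every number recomputed here as a kernel identity):
* A  — `p = 2`, `O = 𝔽₂[x, y]`, `g = y² + x⁵`, `b = q = 2`, `e = 1`: `h(0) = x⁵ = x·∂ₓg`, tail `y` (prior index «Example A»,
  GAP.md G* step 2 — INDEX ONLY; recomputed: `∂ₓg = 5x⁴ = x⁴`).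
* R2 — `p = 3`, `O = 𝔽₃[x₁, x₂, x₃, y]`, `g = y³ + x₁²x₂⁹ + x₁²x₃⁶ + x₂⁹x₃`, `b = q = 3`, `e = 1`: total knock-out `ε = h(0)`
  (two H♭ steps, b2b-hironaka-3/b2b_checks.out R2 — INDEX ONLY) `= 2x₁·∂₁g + x₃·∂₃g`, tail `y` (`∂₁g = 2x₁(x₂⁹ + x₃⁶)`,
  `∂₃g = x₂⁹`, `4 = 1`, `6 = 0` in 𝔽₃).
* E2 — `p = 2`, `O = 𝔽₂[x₁, x₂, y]`, `g = y⁴ + x₁⁵ + x₁²x₂⁶`, `b = q = 4`, **`e = 2`** (OUR two-level head; not in the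
  manuscript, not in the prior index): level 0 knocks out `h(0) = x₁⁵` (case (III): `∂₁ε·∂₁^{(4)}ε = x₁⁴·x₁`), the
  remainder `y⁴ + x₁²x₂⁶ = (y² + x₁x₂³)²` is a square, so `g(1) = y² + x₁x₂³` = example D's head, `h(1) = x₁x₂³`, `g(2) =
  y(2) = y`; POS needs `h(0) + h(1)² = x₁⁵ + x₁²x₂⁶ ∈ ℘(Ě,1)`, NOT a multiple of first derivatives (`∂₁g = x₁⁴`, `∂₂g =
  ∂_y g = 0`: «not automatic for `e ≥ 2`», K1.3) but `= x₁·∂₁g + x₁²·∂₁^{(2)}g` with the ORDER-2 Hasse derivative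
  `∂₁^{(2)}g = x₂⁶ + 10x₁³ = x₂⁶` (tree `Resolution.hasseDeriv`), order `2 < b = 4`.

HONEST FRAMING. Nothing here is a statement of H. Hironaka's manuscript *Resolution of singularities in positive
characteristics* (2017-03-23, [Hironaka2017]); «head», «knock-out», «tail», «H♭», «level» only name the role a
polynomial plays in the recomputation (Rem 9.9–9.11 / Def 9.12 p.51, Eq. (83)–(85) pp.54–56 are CANDIDATES
[claim: Hironaka2017, status: under-review], used only to FIX WHICH polynomial is computed). The ideal exponent of each
example is the hypersurface model `Ě = ((g), b)` of the recorded datum (as in K1.3 and the prior index); `℘(Ě,1)` is the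
BOUND ALGEBRAIC piece `pAlgPiece K (Ideal.span {g}) b 1` (row 003 U17_2; the identification with the geometric `℘` is
the manuscript's candidate U17_4 and is NOT used). What these instances do NOT settle: whether the §9.7 recipe's
knock-outs ALWAYS factor through operators of order `< b` (the general form of rung 1) — see the seat's census job and
CAMPAIGN.md; and RESCUE-SEED's caveat stands (R-flat NON-PROPAGATING would still leave L-G4 / (127) open; barrier of
record `KangarooShadeIncrease.Hauser2003_kangarooShadeIncrease`). AI computation is weaker than expert review; nothing
here is progress on resolution of singularities in positive characteristic.

CONTENTS (all `[folklore]`, sorry-free): §0 two generic membership helpers over `MvPolynomial σ K`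
(`mul_pderiv_mem_diffIdeal`, `hasseDeriv_single_mul_of_mem_supported`, `mul_hasseDeriv_mem_diffIdeal`) and the closing
step `rFlatTailPow_of_pow_mem` (v4 schema from a tail-power membership); §1 Example A (`A_pderiv`, `A_tail_sq`,
`A_tail_sq_mem`, `A_rFlatTailPow`); §2 R2 (`R2_pderiv₁`, `R2_pderiv₃`, `R2_tail_cube`, `R2_tail_cube_mem`,
`R2_rFlatTailPow`); §3 E2 (`E2_chain`, `E2_pderiv` (every FIRST derivative of the head is a polynomial in `x₁` alone —
`x₁⁴, 0, 0` — while the knock-out carries `x₁²x₂⁶`: «not automatic» from first derivatives), `E2_hasse2`, `E2_tail_pow4`,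
`E2_tail_pow4_mem`, `E2_rFlatTailPow`).
-/

noncomputable section

set_option linter.dupNamespace false -- mandated namespace of this single-conjunct summit

namespace Summit.ResolutionOfSingularities.ResolutionOfSingularities.Theorems.Campaign.W13

open MvPolynomial
open Literature.AlgebraicGeometry.Resolution
open Literature.AlgebraicGeometry.Hironaka2017
open Literature.AlgebraicGeometry.Hironaka2017.S09LLUED (LLChainData)

universe u

/-! ## §0 Generic helpers: values of first-order and Hasse derivatives lie in `Diff^{(n)}((g))` -/

section Generic

variable (K : Type u) [CommRing K] {σ : Type}

/-- `c · ∂_i g ∈ Diff^{(1)}((g))·O` — a multiple of a first partial derivative of `g` is a value of an order-`≤ 1`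
`K`-linear differential operator on the ideal `(g)` (Mathlib `MvPolynomial.pderiv` is a derivation; tree
`Resolution.Derivation.isDiffOpLE_one`, `apply_mem_diffIdeal`). [folklore] -/
theorem mul_pderiv_mem_diffIdeal (i : σ) (c g : MvPolynomial σ K) {n : ℕ} (hn : 1 ≤ n) :
    c * pderiv i g ∈ diffIdeal K n (Ideal.span {g}) :=
  Ideal.mul_mem_left _ c (diffIdeal_mono_left K hn _
    (apply_mem_diffIdeal K (Derivation.isDiffOpLE_one (pderiv i : Derivation K (MvPolynomial σ K) _))
      (Ideal.subset_span rfl)))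

/-- Hasse derivatives in the variable `x_i` commute with multiplication by polynomials not involving `x_i`:
`∂_i^{(k)}(f·g) = f·∂_i^{(k)}g` for `f ∈ K[x_s : s ∈ S]`, `i ∉ S` (Leibniz rule `hasseDeriv_mul` with all terms but one
killed by `hasseDeriv_eq_zero_of_mem_supported`). [folklore] -/
theorem hasseDeriv_single_mul_of_mem_supported [DecidableEq σ] {S : Set σ} {f : MvPolynomial σ K}
    (hf : f ∈ supported K S)
    {i : σ} (hi : i ∉ S) (k : ℕ) (g : MvPolynomial σ K) :
    hasseDeriv K (Finsupp.single i k) (f * g) = f * hasseDeriv K (Finsupp.single i k) g := by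
  rw [hasseDeriv_mul, Finset.sum_eq_single (0, Finsupp.single i k)]
  · rw [hasseDeriv_zero, LinearMap.id_apply]
  · intro q hq hne
    have hsum : q.1 + q.2 = Finsupp.single i k := Finset.mem_antidiagonal.mp hq
    have hq1 : q.1 i ≠ 0 := by
      intro h0
      apply hne
      have h1 : q.1 = 0 := by
        ext j
        by_cases hj : j = i
        · subst hj; simpa using h0
        · have hj' := congrArg (fun f : σ →₀ ℕ => f j) hsum
          simp only [Finsupp.coe_add, Pi.add_apply, Finsupp.single_apply, if_neg (Ne.symm hj)] at hj'
          simp only [Finsupp.coe_zero, Pi.zero_apply]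
          omega
      refine Prod.ext h1 ?_
      simpa [h1] using hsum
    rw [hasseDeriv_eq_zero_of_mem_supported K hf hi hq1, zero_mul]
  · intro h
    exact absurd (Finset.mem_antidiagonal.mpr (zero_add _)) h

/-- `c · ∂^{(β)} g ∈ Diff^{(n)}((g))·O` for `|β| ≤ n` (tree `Resolution.hasseDeriv_apply_mem_diffIdeal`). [folklore] -/
theorem mul_hasseDeriv_mem_diffIdeal [DecidableEq σ] {n : ℕ} {β : σ →₀ ℕ} (hβ : β.degree ≤ n)
    (c g : MvPolynomial σ K) :
    c * hasseDeriv K β g ∈ diffIdeal K n (Ideal.span {g}) :=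
  Ideal.mul_mem_left _ c (hasseDeriv_apply_mem_diffIdeal K hβ (Ideal.subset_span rfl))

end Generic

section Schema

variable {K : Type u} [CommRing K] {O : Type u} [CommRing O] [Algebra K O] {p : ℕ}

/-- Closing step: v4's schema `RFlatTailPow p K J b d` for ANY chain datum `d` (row 061 `LLChainData`) with exponent
`d.e = e` and tail `d.tail = τ` follows from the one membership `τ^{p^e} ∈ ℘(Ě,1)` (bound). The chain predicate the
campaign binds (v4 `RFlatTailPowOn`'s parameter) plays no role in this direction. [folklore] -/
theorem rFlatTailPow_of_pow_mem {J : Ideal O} {b e : ℕ} {τ : O} (hτ : τ ^ p ^ e ∈ Campaign.pAlgPiece K J b 1)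
    (d : LLChainData O) (hde : d.e = e) (hdt : d.tail = τ) : Campaign.RFlatTailPow p K J b d := by
  rw [Campaign.RFlatTailPow, hdt, hde]
  exact hτ

end Schema

/-! ## §1 Example A: `g = y² + x⁵`, `p = 2`, `b = q = 2`, `e = 1` (`X 0 = x`, `X 1 = y`) -/

section ExampleA

/-- `∂ₓ g_A = x⁴` (`5 = 1` in characteristic 2). [folklore] -/
theorem A_pderiv :
    pderiv 0 (X 1 ^ 2 + X 0 ^ 5 : MvPolynomial (Fin 2) (ZMod 2)) = X 0 ^ 4 := by
  have h4 : (4 : MvPolynomial (Fin 2) (ZMod 2)) = 0 := by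
    have h2 : (2 : MvPolynomial (Fin 2) (ZMod 2)) = 0 := CharTwo.two_eq_zero
    have : (4 : MvPolynomial (Fin 2) (ZMod 2)) = 2 * 2 := by norm_num
    rw [this, h2, mul_zero]
  have h10 : (1 : Fin 2) ≠ 0 := by decide
  simp only [map_add, pderiv_pow, pderiv_X_self, pderiv_X_of_ne h10, mul_zero, zero_add, mul_one]
  push_cast
  linear_combination (X 0 ^ 4 : MvPolynomial (Fin 2) (ZMod 2)) * h4

/-- The A-column identity: head minus knock-out is the square of the tail, with the knock-out a multiple of a first
derivative — `y² = g_A + x·∂ₓg_A` (characteristic 2; `h(0) = x⁵`, tail `y`). [folklore] -/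
theorem A_tail_sq :
    (X 1 : MvPolynomial (Fin 2) (ZMod 2)) ^ 2 ^ 1 =
      (X 1 ^ 2 + X 0 ^ 5) + X 0 * pderiv 0 (X 1 ^ 2 + X 0 ^ 5 : MvPolynomial (Fin 2) (ZMod 2)) := by
  rw [A_pderiv]
  have h2 : (2 : MvPolynomial (Fin 2) (ZMod 2)) = 0 := CharTwo.two_eq_zero
  linear_combination (-(X 0 ^ 5) : MvPolynomial (Fin 2) (ZMod 2)) * h2

/-- POS_A in the bound vocabulary: `y² ∈ ℘(Ě_A, 1)` for `Ě_A = ((y² + x⁵), 2)` (algebraic `℘`, v3 `pAlgPiece`).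
[folklore] -/
theorem A_tail_sq_mem :
    (X 1 : MvPolynomial (Fin 2) (ZMod 2)) ^ 2 ^ 1 ∈
      Campaign.pAlgPiece (ZMod 2) (Ideal.span {(X 1 ^ 2 + X 0 ^ 5 : MvPolynomial (Fin 2) (ZMod 2))}) 2 1 := by
  rw [A_tail_sq]
  refine diffIdeal_le_pAlgPiece_one (ZMod 2) _ (by norm_num) (show 1 < 2 by norm_num) ?_
  exact Ideal.add_mem _ (le_diffIdeal (ZMod 2) 1 _ (Ideal.subset_span rfl))
    (mul_pderiv_mem_diffIdeal (ZMod 2) 0 _ _ le_rfl)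

/-- SECOND CHECK (a), Example A: `RFlatTailPow` holds for every chain datum over `𝔽₂[x,y]` with exponent `e = 1` and
tail `y`, for `Ě_A = ((y² + x⁵), 2)`. [folklore] -/
theorem A_rFlatTailPow (d : LLChainData (MvPolynomial (Fin 2) (ZMod 2))) (hde : d.e = 1)
    (hdt : d.tail = X 1) :
    Campaign.RFlatTailPow 2 (ZMod 2) (Ideal.span {(X 1 ^ 2 + X 0 ^ 5 : MvPolynomial (Fin 2) (ZMod 2))}) 2 d :=
  rFlatTailPow_of_pow_mem A_tail_sq_mem d hde hdt

end ExampleA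

/-! ## §2 The `p = 3` specimen R2: `g = y³ + x₁²x₂⁹ + x₁²x₃⁶ + x₂⁹x₃`, `b = q = 3`, `e = 1`
(`X 0 = x₁`, `X 1 = x₂`, `X 2 = x₃`, `X 3 = y`) -/

section SpecimenR2

/-- `∂₁ g_{R2} = 2x₁x₂⁹ + 2x₁x₃⁶`. [folklore] -/
theorem R2_pderiv₁ :
    pderiv 0 (X 3 ^ 3 + X 0 ^ 2 * X 1 ^ 9 + X 0 ^ 2 * X 2 ^ 6 + X 1 ^ 9 * X 2 : MvPolynomial (Fin 4) (ZMod 3)) =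
      2 * (X 0 * X 1 ^ 9) + 2 * (X 0 * X 2 ^ 6) := by
  have h10 : (1 : Fin 4) ≠ 0 := by decide
  have h20 : (2 : Fin 4) ≠ 0 := by decide
  have h30 : (3 : Fin 4) ≠ 0 := by decide
  simp only [map_add, pderiv_mul, pderiv_pow, pderiv_X_self, pderiv_X_of_ne h10, pderiv_X_of_ne h20,
    pderiv_X_of_ne h30, mul_zero, zero_add, add_zero, mul_one, zero_mul]
  push_cast
  ring

/-- `∂₃ g_{R2} = x₂⁹` (`6 = 0` in characteristic 3). [folklore] -/
theorem R2_pderiv₃ :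
    pderiv 2 (X 3 ^ 3 + X 0 ^ 2 * X 1 ^ 9 + X 0 ^ 2 * X 2 ^ 6 + X 1 ^ 9 * X 2 : MvPolynomial (Fin 4) (ZMod 3)) =
      X 1 ^ 9 := by
  have h3 : (3 : MvPolynomial (Fin 4) (ZMod 3)) = 0 := by
    exact_mod_cast (CharP.cast_eq_zero (MvPolynomial (Fin 4) (ZMod 3)) 3)
  have h02 : (0 : Fin 4) ≠ 2 := by decide
  have h12 : (1 : Fin 4) ≠ 2 := by decide
  have h32 : (3 : Fin 4) ≠ 2 := by decide
  simp only [map_add, pderiv_mul, pderiv_pow, pderiv_X_self, pderiv_X_of_ne h02, pderiv_X_of_ne h12,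
    pderiv_X_of_ne h32, mul_zero, zero_add, add_zero, mul_one, zero_mul]
  push_cast
  linear_combination (2 * X 0 ^ 2 * X 2 ^ 5 : MvPolynomial (Fin 4) (ZMod 3)) * h3

/-- The R2-column identity: `y³ = g − 2x₁·∂₁g − x₃·∂₃g` — the total knock-out `ε = x₁²x₂⁹ + x₁²x₃⁶ + x₂⁹x₃`
(both H♭ steps together) is a combination of first derivatives of `g`; tail `y`. [folklore] -/
theorem R2_tail_cube :
    (X 3 : MvPolynomial (Fin 4) (ZMod 3)) ^ 3 ^ 1 =
      (X 3 ^ 3 + X 0 ^ 2 * X 1 ^ 9 + X 0 ^ 2 * X 2 ^ 6 + X 1 ^ 9 * X 2)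
        - 2 * X 0 * pderiv 0 (X 3 ^ 3 + X 0 ^ 2 * X 1 ^ 9 + X 0 ^ 2 * X 2 ^ 6 + X 1 ^ 9 * X 2 :
            MvPolynomial (Fin 4) (ZMod 3))
        - X 2 * pderiv 2 (X 3 ^ 3 + X 0 ^ 2 * X 1 ^ 9 + X 0 ^ 2 * X 2 ^ 6 + X 1 ^ 9 * X 2 :
            MvPolynomial (Fin 4) (ZMod 3)) := by
  rw [R2_pderiv₁, R2_pderiv₃]
  have h3 : (3 : MvPolynomial (Fin 4) (ZMod 3)) = 0 := by
    exact_mod_cast (CharP.cast_eq_zero (MvPolynomial (Fin 4) (ZMod 3)) 3)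
  linear_combination (X 0 ^ 2 * X 1 ^ 9 + X 0 ^ 2 * X 2 ^ 6 : MvPolynomial (Fin 4) (ZMod 3)) * h3

/-- POS_{R2} in the bound vocabulary: `y³ ∈ ℘(Ě_{R2}, 1)`, `Ě_{R2} = ((g_{R2}), 3)`. [folklore] -/
theorem R2_tail_cube_mem :
    (X 3 : MvPolynomial (Fin 4) (ZMod 3)) ^ 3 ^ 1 ∈
      Campaign.pAlgPiece (ZMod 3)
        (Ideal.span {(X 3 ^ 3 + X 0 ^ 2 * X 1 ^ 9 + X 0 ^ 2 * X 2 ^ 6 + X 1 ^ 9 * X 2 :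
          MvPolynomial (Fin 4) (ZMod 3))}) 3 1 := by
  rw [R2_tail_cube]
  refine diffIdeal_le_pAlgPiece_one (ZMod 3) _ (by norm_num) (show 1 < 3 by norm_num) ?_
  exact Ideal.sub_mem _ (Ideal.sub_mem _ (le_diffIdeal (ZMod 3) 1 _ (Ideal.subset_span rfl))
    (mul_pderiv_mem_diffIdeal (ZMod 3) 0 (2 * X 0) _ le_rfl)) (mul_pderiv_mem_diffIdeal (ZMod 3) 2 (X 2) _ le_rfl)

/-- SECOND CHECK (a), specimen R2: `RFlatTailPow` holds for every chain datum over `𝔽₃[x₁,x₂,x₃,y]` with `e = 1` and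
tail `y`, for `Ě_{R2} = ((g_{R2}), 3)`. [folklore] -/
theorem R2_rFlatTailPow (d : LLChainData (MvPolynomial (Fin 4) (ZMod 3))) (hde : d.e = 1) (hdt : d.tail = X 3) :
    Campaign.RFlatTailPow 3 (ZMod 3)
      (Ideal.span {(X 3 ^ 3 + X 0 ^ 2 * X 1 ^ 9 + X 0 ^ 2 * X 2 ^ 6 + X 1 ^ 9 * X 2 :
        MvPolynomial (Fin 4) (ZMod 3))}) 3 d :=
  rFlatTailPow_of_pow_mem R2_tail_cube_mem d hde hdt

end SpecimenR2

/-! ## §3 The `e = 2` head E2: `g = y⁴ + x₁⁵ + x₁²x₂⁶`, `p = 2`, `b = q = 4` (`X 0 = x₁`, `X 1 = x₂`, `X 2 = y`) -/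

section HeadE2

/-- The two-level chain of E2 as ring identities in characteristic 2: level 0 `g = g(1)² + h(0)` with `g(1) = y² + x₁x₂³`
(example D's head), `h(0) = x₁⁵`; level 1 `g(1) = g(2)² + h(1)` with `g(2) = y`, `h(1) = x₁x₂³`; telescoped
`y⁴ = g − h(0) − h(1)²` (signs immaterial in characteristic 2). [folklore] -/
theorem E2_chain {R : Type*} [CommRing R] [CharP R 2] (x₁ x₂ y : R) :
    y ^ 4 + x₁ ^ 5 + x₁ ^ 2 * x₂ ^ 6 = (y ^ 2 + x₁ * x₂ ^ 3) ^ 2 + x₁ ^ 5 ∧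
      y ^ 2 + x₁ * x₂ ^ 3 = y ^ 2 + x₁ * x₂ ^ 3 ∧
        y ^ 4 = (y ^ 4 + x₁ ^ 5 + x₁ ^ 2 * x₂ ^ 6) + x₁ ^ 5 + (x₁ * x₂ ^ 3) ^ 2 := by
  have h2 : (2 : R) = 0 := CharTwo.two_eq_zero
  refine ⟨?_, rfl, ?_⟩
  · linear_combination (-(y ^ 2 * x₁ * x₂ ^ 3) : R) * h2
  · linear_combination (-(x₁ ^ 5 + x₁ ^ 2 * x₂ ^ 6) : R) * h2

/-- `∂₁ g_{E2} = x₁⁴` (`5 = 1`, `2 = 0`), and `∂₂ g_{E2} = 0`, `∂_y g_{E2} = 0`: every FIRST derivative of the head is a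
polynomial in `x₁` alone. [folklore] -/
theorem E2_pderiv :
    pderiv 0 (X 2 ^ 4 + X 0 ^ 5 + X 0 ^ 2 * X 1 ^ 6 : MvPolynomial (Fin 3) (ZMod 2)) = X 0 ^ 4 ∧
      pderiv 1 (X 2 ^ 4 + X 0 ^ 5 + X 0 ^ 2 * X 1 ^ 6 : MvPolynomial (Fin 3) (ZMod 2)) = 0 ∧
        pderiv 2 (X 2 ^ 4 + X 0 ^ 5 + X 0 ^ 2 * X 1 ^ 6 : MvPolynomial (Fin 3) (ZMod 2)) = 0 := by
  have h2 : (2 : MvPolynomial (Fin 3) (ZMod 2)) = 0 := CharTwo.two_eq_zero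
  have h10 : (1 : Fin 3) ≠ 0 := by decide
  have h20 : (2 : Fin 3) ≠ 0 := by decide
  have h01 : (0 : Fin 3) ≠ 1 := by decide
  have h21 : (2 : Fin 3) ≠ 1 := by decide
  have h02 : (0 : Fin 3) ≠ 2 := by decide
  have h12 : (1 : Fin 3) ≠ 2 := by decide
  refine ⟨?_, ?_, ?_⟩
  · simp only [map_add, pderiv_mul, pderiv_pow, pderiv_X_self, pderiv_X_of_ne h10, pderiv_X_of_ne h20, mul_zero,
      zero_add, add_zero, mul_one]
    push_cast
    linear_combination (2 * X 0 ^ 4 + X 0 * X 1 ^ 6 : MvPolynomial (Fin 3) (ZMod 2)) * h2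
  · simp only [map_add, pderiv_mul, pderiv_pow, pderiv_X_self, pderiv_X_of_ne h01, pderiv_X_of_ne h21, mul_zero,
      zero_add, add_zero, mul_one, zero_mul]
    push_cast
    linear_combination (3 * X 0 ^ 2 * X 1 ^ 5 : MvPolynomial (Fin 3) (ZMod 2)) * h2
  · simp only [map_add, pderiv_mul, pderiv_pow, pderiv_X_self, pderiv_X_of_ne h02, pderiv_X_of_ne h12, mul_zero,
      add_zero, mul_one, zero_mul]
    push_cast
    linear_combination (2 * X 2 ^ 3 : MvPolynomial (Fin 3) (ZMod 2)) * h2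

/-- The ORDER-2 Hasse derivative in `x₁` of the head: `∂₁^{(2)} g_{E2} = x₂⁶` (`binom(5,2) = 10 = 0`, `binom(2,2) = 1`;
tree `Resolution.hasseDeriv`, multi-index `2·e₀`). [folklore] -/
theorem E2_hasse2 :
    hasseDeriv (ZMod 2) (Finsupp.single 0 2) (X 2 ^ 4 + X 0 ^ 5 + X 0 ^ 2 * X 1 ^ 6 : MvPolynomial (Fin 3) (ZMod 2)) =
      X 1 ^ 6 := by
  have hX2 : (X 2 : MvPolynomial (Fin 3) (ZMod 2)) ∈ supported (ZMod 2) ({2} : Set (Fin 3)) :=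
    (X_mem_supported (R := ZMod 2)).mpr (Set.mem_singleton _)
  have hX24 : (X 2 ^ 4 : MvPolynomial (Fin 3) (ZMod 2)) ∈ supported (ZMod 2) ({2} : Set (Fin 3)) :=
    pow_mem hX2 4
  have h02 : (0 : Fin 3) ∉ ({2} : Set (Fin 3)) := by simp
  have hy : hasseDeriv (ZMod 2) (Finsupp.single (0 : Fin 3) 2) (X 2 ^ 4 : MvPolynomial (Fin 3) (ZMod 2)) = 0 :=
    hasseDeriv_eq_zero_of_mem_supported (ZMod 2) hX24 h02 (by rw [Finsupp.single_eq_same]; decide)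
  have hx : hasseDeriv (ZMod 2) (Finsupp.single (0 : Fin 3) 2) (X 0 ^ 5 : MvPolynomial (Fin 3) (ZMod 2)) = 0 := by
    have h2 : (2 : MvPolynomial (Fin 3) (ZMod 2)) = 0 := CharTwo.two_eq_zero
    rw [hasseDeriv_X_pow, show Nat.choose 5 2 = 10 from rfl, show (5 : ℕ) - 2 = 3 from rfl]
    push_cast
    linear_combination (5 * X 0 ^ 3 : MvPolynomial (Fin 3) (ZMod 2)) * h2
  have hxx : hasseDeriv (ZMod 2) (Finsupp.single (0 : Fin 3) 2) (X 0 ^ 2 * X 1 ^ 6 : MvPolynomial (Fin 3) (ZMod 2)) =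
      X 1 ^ 6 := by
    have hX1 : (X 1 : MvPolynomial (Fin 3) (ZMod 2)) ∈ supported (ZMod 2) ({1} : Set (Fin 3)) :=
      (X_mem_supported (R := ZMod 2)).mpr (Set.mem_singleton _)
    have hX16 : (X 1 ^ 6 : MvPolynomial (Fin 3) (ZMod 2)) ∈ supported (ZMod 2) ({1} : Set (Fin 3)) :=
      pow_mem hX1 6
    have h01 : (0 : Fin 3) ∉ ({1} : Set (Fin 3)) := by simp
    rw [mul_comm, hasseDeriv_single_mul_of_mem_supported (ZMod 2) hX16 h01, hasseDeriv_X_pow,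
      Nat.choose_self, Nat.cast_one, one_mul, Nat.sub_self, pow_zero, mul_one]
  rw [map_add, map_add, hy, hx, hxx, zero_add, zero_add]

/-- The E2-column identity: `y⁴ = g + x₁·∂₁g + x₁²·∂₁^{(2)}g` — the total knock-out `h(0) + h(1)² = x₁⁵ + x₁²x₂⁶` is a
value of differential operators of orders `1` and `2 < b = 4` on `g` (characteristic 2). [folklore] -/
theorem E2_tail_pow4 :
    (X 2 : MvPolynomial (Fin 3) (ZMod 2)) ^ 2 ^ 2 =
      (X 2 ^ 4 + X 0 ^ 5 + X 0 ^ 2 * X 1 ^ 6)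
        + X 0 * pderiv 0 (X 2 ^ 4 + X 0 ^ 5 + X 0 ^ 2 * X 1 ^ 6 : MvPolynomial (Fin 3) (ZMod 2))
        + X 0 ^ 2 * hasseDeriv (ZMod 2) (Finsupp.single 0 2)
            (X 2 ^ 4 + X 0 ^ 5 + X 0 ^ 2 * X 1 ^ 6 : MvPolynomial (Fin 3) (ZMod 2)) := by
  rw [E2_pderiv.1, E2_hasse2]
  have h2 : (2 : MvPolynomial (Fin 3) (ZMod 2)) = 0 := CharTwo.two_eq_zero
  linear_combination (-(X 0 ^ 5 + X 0 ^ 2 * X 1 ^ 6) : MvPolynomial (Fin 3) (ZMod 2)) * h2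

/-- POS_{E2} in the bound vocabulary: `y⁴ ∈ ℘(Ě_{E2}, 1)`, `Ě_{E2} = ((y⁴ + x₁⁵ + x₁²x₂⁶), 4)` — through
`Diff^{(3)}((g)) ⊆ ℘(Ě,1)` (orders `1, 2 ≤ 3 < 4`). [folklore] -/
theorem E2_tail_pow4_mem :
    (X 2 : MvPolynomial (Fin 3) (ZMod 2)) ^ 2 ^ 2 ∈
      Campaign.pAlgPiece (ZMod 2)
        (Ideal.span {(X 2 ^ 4 + X 0 ^ 5 + X 0 ^ 2 * X 1 ^ 6 : MvPolynomial (Fin 3) (ZMod 2))}) 4 1 := by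
  rw [E2_tail_pow4]
  refine diffIdeal_le_pAlgPiece_one (ZMod 2) _ (by norm_num) (show 3 < 4 by norm_num) ?_
  refine Ideal.add_mem _ (Ideal.add_mem _ (le_diffIdeal (ZMod 2) 3 _ (Ideal.subset_span rfl)) ?_) ?_
  · exact mul_pderiv_mem_diffIdeal (ZMod 2) 0 (X 0) _ (by norm_num)
  · exact mul_hasseDeriv_mem_diffIdeal (ZMod 2) (by rw [Finsupp.degree_single]; norm_num) _ _

/-- SECOND CHECK (a), the `e = 2` head: `RFlatTailPow` holds for every chain datum over `𝔽₂[x₁,x₂,y]` with exponent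
`e = 2` and tail `y`, for `Ě_{E2} = ((y⁴ + x₁⁵ + x₁²x₂⁶), 4)` — a level-1 knock-out `h(1) = x₁x₂³ ≠ 0` whose square's
membership comes from an ORDER-2 Hasse derivative (`E2_tail_pow4`), the first derivatives being `x₁⁴, 0, 0`
(`E2_pderiv`). [folklore] -/
theorem E2_rFlatTailPow (d : LLChainData (MvPolynomial (Fin 3) (ZMod 2))) (hde : d.e = 2) (hdt : d.tail = X 2) :
    Campaign.RFlatTailPow 2 (ZMod 2)
      (Ideal.span {(X 2 ^ 4 + X 0 ^ 5 + X 0 ^ 2 * X 1 ^ 6 : MvPolynomial (Fin 3) (ZMod 2))}) 4 d :=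
  rFlatTailPow_of_pow_mem E2_tail_pow4_mem d hde hdt

end HeadE2

end Summit.ResolutionOfSingularities.ResolutionOfSingularities.Theorems.Campaign.W13

end
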